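import Mathlib
import Summits.AtomisticToContinuum.Crystallization.Theses.PhononSlackCertificates
import Summits.AtomisticToContinuum.Crystallization.Theorems.PhononSlackCertificatesNearFarGlueRPeriodicInsertion
import Summits.AtomisticToContinuum.Crystallization.Theorems.PhononSlackCertificatesNearFarGlueRHcpBoxSubset
import Summits.AtomisticToContinuum.Crystallization.Theorems.ChargedEnergyGap.Negative.BlocksBound
import Literature.MathematicalPhysics.StatisticalMechanics.PeriodicConfigurationSums

/-!
# Crux `PhononSlackCertificates.NearFarGlueR` (stmt-AtomisticToContinuum-14970), line `Sketch`:
the LOOSE and MOVE species in the REPAIR form — cone-free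

Continuation lead c5.  Companion of `…NearFarGlueRTorusHoles.lean`.  Removing the orbit of a
motif point `w` is the periodic insertion identity (`stub_periodicInsertion`) read backwards
through `exists_erase_periodicConfiguration`: with `n = #motif ≥ 2`,
`2(n−1)·e(P ⊖ w) = 2n·e(P) − 2·W_w(P ⊖ w) − T`, and the binding sum of `w` in `P` splits at its
own orbit, `B_w(P) = W_w(P ⊖ w) + T` (`tsum_points_eq_tsum_add_tsum_lattice`), `T = Σ'_{g≠0}V(|g|)
≤ 0` for periods `≥ 9/10`.  Hence (`eStar_add_le_of_loose` = registered sub-goal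
`stub_torusLoose`): **if `w` is LOOSE — its full binding `B_w(P) = Σ'_{q ∈ P.points, q ≠ w} V(dist w q)`
is at least `e(P) + G` — then `e* + G/(n−1) ≤ e(P)`.**  In the finite setting (c3, `loose_gap`)
the threshold was the certified upper cone `−0.711`; on the torus it is the explicit `e(P)`: no
trial-state or stability constant enters.  And the periodic MOVE principle
(`eStar_add_le_of_move`): moving the orbit of `w` to a site `p` off the other orbits changes the
energy per particle by exactly `(W_p(P ⊖ w) − W_w(P ⊖ w))/n` (removal then insertion; the
translates' sums cancel), so a site binding better by `G` certifies `e* + G/n ≤ e(P)` — c4's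
move-stability, on the torus.  All `[folklore]`.
-/

noncomputable section

namespace Summit.AtomisticToContinuum.Crystallization.Theorems.PhononSlackCertificatesNearFarGlueR

open Literature.MathematicalPhysics.StatisticalMechanics
open Literature.Geometry.DiscreteGeometry
open Summit.AtomisticToContinuum.Crystallization.Theses.PhononSlackCertificates
open scoped BigOperators Classical

/-- **Splitting the binding sum of a point of `P` at its own orbit.**  For `w ∈ P.points` and a
configuration `P₀` with `P.points = P₀.points ⊔ (w + periods)` (`w ∉ P₀.points`):
`Σ'_{q ∈ P.points, q ≠ w} V(dist w q) = Σ'_{q ∈ P₀.points, q ≠ w} V(dist w q) + Σ'_{g ≠ 0} V(‖g‖)`.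
[folklore] -/
theorem tsum_points_eq_tsum_add_tsum_lattice (P P₀ : PeriodicConfiguration 3)
    {w : EuclideanSpace ℝ (Fin 3)}
    (h0l : ∀ g : EuclideanSpace ℝ (Fin 3), g ∈ P₀.lattice ↔ g ∈ P.lattice)
    (h0p : ∀ q : EuclideanSpace ℝ (Fin 3),
      q ∈ P₀.points ↔ (q ∈ P.points ∧ ¬ ∃ g ∈ P.lattice, q = w + g))
    (hpts : ∀ q : EuclideanSpace ℝ (Fin 3),
      q ∈ P.points ↔ (q ∈ P₀.points ∨ ∃ g ∈ P₀.lattice, q = w + g)) :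
    (∑' q : {q : EuclideanSpace ℝ (Fin 3) // q ∈ P.points ∧ q ≠ w}, lennardJones (dist w q.1)) =
      (∑' q : {q : EuclideanSpace ℝ (Fin 3) // q ∈ P₀.points ∧ q ≠ w}, lennardJones (dist w q.1)) +
        ∑' g : {g : EuclideanSpace ℝ (Fin 3) // g ∈ P.lattice ∧ g ≠ 0}, lennardJones ‖g.1‖ := by
  have hsum := P.summable_lennardJones_dist_three w
  set f : {q : EuclideanSpace ℝ (Fin 3) // q ∈ P.points ∧ q ≠ w} → ℝ :=
    fun q => lennardJones (dist w q.1) with hf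
  set s : Set {q : EuclideanSpace ℝ (Fin 3) // q ∈ P.points ∧ q ≠ w} := {q | q.1 ∈ P₀.points}
    with hs
  have hsplit := (hsum.tsum_subtype_add_tsum_subtype_compl s).symm
  -- the `s` part
  have hsub : P₀.points ⊆ P.points := fun q hq => ((h0p q).1 hq).1
  let e₁ : ↥s ≃ {q : EuclideanSpace ℝ (Fin 3) // q ∈ P₀.points ∧ q ≠ w} :=
    { toFun := fun q => ⟨q.1.1, q.2, q.1.2.2⟩
      invFun := fun q => ⟨⟨q.1, hsub q.2.1, q.2.2⟩, q.2.1⟩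
      left_inv := fun q => by ext; rfl
      right_inv := fun q => by ext; rfl }
  have h1 : (∑' q : ↥s, f q) =
      ∑' q : {q : EuclideanSpace ℝ (Fin 3) // q ∈ P₀.points ∧ q ≠ w}, lennardJones (dist w q.1) := by
    rw [← Equiv.tsum_eq e₁.symm]; rfl
  -- the complement: the orbit of `w` minus `w`
  have hmemc : ∀ g : {g : EuclideanSpace ℝ (Fin 3) // g ∈ P.lattice ∧ g ≠ 0},
      (⟨w + g.1, ⟨(hpts _).2 (Or.inr ⟨g.1, (h0l _).2 g.2.1, rfl⟩), fun h => g.2.2 (by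
        simpa using h)⟩⟩ : {q : EuclideanSpace ℝ (Fin 3) // q ∈ P.points ∧ q ≠ w}) ∈ sᶜ := by
    intro g hmem
    have := ((h0p _).1 hmem).2
    exact this ⟨g.1, g.2.1, rfl⟩
  let φ : {g : EuclideanSpace ℝ (Fin 3) // g ∈ P.lattice ∧ g ≠ 0} → ↥sᶜ := fun g =>
    ⟨⟨w + g.1, ⟨(hpts _).2 (Or.inr ⟨g.1, (h0l _).2 g.2.1, rfl⟩), fun h => g.2.2 (by
        simpa using h)⟩⟩, hmemc g⟩
  have hφ : Function.Bijective φ := by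
    constructor
    · intro g g' h
      have : w + g.1 = w + g'.1 := congrArg (fun z : ↥sᶜ => z.1.1) h
      exact Subtype.ext (add_left_cancel this)
    · intro q
      have hq : q.1.1 ∈ P.points := q.1.2.1
      have hqw : q.1.1 ≠ w := q.1.2.2
      have hq0 : q.1.1 ∉ P₀.points := q.2
      rcases (hpts _).1 hq with h | ⟨g, hg, hgq⟩
      · exact absurd h hq0
      · have hg0 : g ≠ 0 := by
          rintro rfl
          exact hqw (by rw [hgq, add_zero])
        refine ⟨⟨g, (h0l g).1 hg, hg0⟩, ?_⟩
        apply Subtype.ext; apply Subtype.ext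
        exact hgq.symm
  have h2 : (∑' q : ↥sᶜ, f q) =
      ∑' g : {g : EuclideanSpace ℝ (Fin 3) // g ∈ P.lattice ∧ g ≠ 0}, lennardJones ‖g.1‖ := by
    rw [← Equiv.tsum_eq (Equiv.ofBijective φ hφ)]
    refine tsum_congr fun g => ?_
    simp only [hf, Equiv.ofBijective_apply, φ]
    rw [dist_eq_norm, show w - (w + g.1) = -g.1 by abel, norm_neg]
  calc (∑' q : {q : EuclideanSpace ℝ (Fin 3) // q ∈ P.points ∧ q ≠ w}, lennardJones (dist w q.1))
      = ∑' q, f q := rfl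
    _ = (∑' q : ↥s, f q) + ∑' q : ↥sᶜ, f q := hsplit
    _ = _ := by rw [h1, h2]

/-- **A loose orbit certifies a gap, cone-free.**  If the non-zero periods have length `≥ 9/10`,
the motif has at least two points, and the motif point `w` is LOOSE — its full binding
`B_w(P) = Σ'_{q ∈ P.points, q ≠ w} V(dist w q)` exceeds the current energy per particle,
`e(P) + G ≤ B_w(P)` — then removing its orbit gains: `e* + G/(n−1) ≤ e(P)`. [folklore] -/
theorem eStar_add_le_of_loose (P : PeriodicConfiguration 3) {w : EuclideanSpace ℝ (Fin 3)}
    (hw : w ∈ P.motif) (h2 : 2 ≤ P.motif.card)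
    (hper : ∀ g ∈ P.lattice, g ≠ 0 → (9 / 10 : ℝ) ≤ ‖g‖) {G : ℝ}
    (hB : P.energyPerParticle lennardJones + G ≤
      ∑' q : {q : EuclideanSpace ℝ (Fin 3) // q ∈ P.points ∧ q ≠ w}, lennardJones (dist w q.1)) :
    (⨅ Q : PeriodicConfiguration 3, Q.energyPerParticle lennardJones) + G / ((P.motif.card : ℝ) - 1)
      ≤ P.energyPerParticle lennardJones := by
  obtain ⟨P₀, h0m, h0l, h0p, hmotif, hpts, ρ, hρ, hclear⟩ :=
    exists_erase_periodicConfiguration P hw h2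
  have hId := stub_periodicInsertion P₀ P w ρ hρ hclear hmotif hpts
  have hT : (∑' g : {g : EuclideanSpace ℝ (Fin 3) // g ∈ P₀.lattice ∧ g ≠ 0},
      lennardJones ‖g.1‖) ≤ 0 :=
    tsum_nonpos fun g => lennardJones_nonpos_of_ge_nine_tenths (hper g.1 ((h0l g.1).1 g.2.1) g.2.2)
  have hsplit := tsum_points_eq_tsum_add_tsum_lattice P P₀ h0l h0p hpts
  -- identify the two lattice sums (same lattice)
  have hlat : (∑' g : {g : EuclideanSpace ℝ (Fin 3) // g ∈ P₀.lattice ∧ g ≠ 0}, lennardJones ‖g.1‖) =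
      ∑' g : {g : EuclideanSpace ℝ (Fin 3) // g ∈ P.lattice ∧ g ≠ 0}, lennardJones ‖g.1‖ := by
    let e : {g : EuclideanSpace ℝ (Fin 3) // g ∈ P₀.lattice ∧ g ≠ 0} ≃
        {g : EuclideanSpace ℝ (Fin 3) // g ∈ P.lattice ∧ g ≠ 0} :=
      { toFun := fun g => ⟨g.1, (h0l g.1).1 g.2.1, g.2.2⟩
        invFun := fun g => ⟨g.1, (h0l g.1).2 g.2.1, g.2.2⟩
        left_inv := fun g => by ext; rfl
        right_inv := fun g => by ext; rfl }
    rw [← Equiv.tsum_eq e.symm]; rfl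
  have hcard0 : (P₀.motif.card : ℝ) = P.motif.card - 1 := by
    rw [h0m, Finset.card_erase_of_mem hw]
    have : 1 ≤ P.motif.card := by omega
    push_cast [Nat.cast_sub this]
    ring
  have hn : (1 : ℝ) ≤ (P.motif.card : ℝ) - 1 := by
    have : (2 : ℝ) ≤ P.motif.card := by exact_mod_cast h2
    linarith
  have hstar : (⨅ Q : PeriodicConfiguration 3, Q.energyPerParticle lennardJones) ≤
      P₀.energyPerParticle lennardJones :=
    ciInf_le ChargedEnergyGapNegative.bddBelow_energyPerParticle_lennardJones P₀
  rw [hcard0, hlat] at hId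
  -- (n-1) e(P₀) ≤ (n-1) e(P) - G
  have hmain : ((P.motif.card : ℝ) - 1) * P₀.energyPerParticle lennardJones ≤
      ((P.motif.card : ℝ) - 1) * P.energyPerParticle lennardJones - G := by
    nlinarith [hId, hT, hsplit, hB, hlat]
  have hdiv : G / ((P.motif.card : ℝ) - 1) ≤
      P.energyPerParticle lennardJones - P₀.energyPerParticle lennardJones := by
    rw [div_le_iff₀ (by linarith)]
    nlinarith
  linarith

/-- **The periodic MOVE principle, cone-free.**  Moving the orbit of a motif point `w` to a new
position `p` (clearance `ρ > 0` from the other orbits) changes the energy per particle by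
`(W_p(P ⊖ w) − W_w(P ⊖ w))/n` exactly — removal then insertion, the translates' sums cancel.
Hence if the new site binds better by `G` to the rest, `W_p(P ⊖ w) ≤ W_w(P ⊖ w) − G` (both
binding sums read in `P` over the points off the orbit of `w`), then `e* + G/n ≤ e(P)`.
[folklore] -/
theorem eStar_add_le_of_move (P : PeriodicConfiguration 3) {w p : EuclideanSpace ℝ (Fin 3)}
    (hw : w ∈ P.motif) (h2 : 2 ≤ P.motif.card) {ρ : ℝ} (hρ : 0 < ρ)
    (hclear : ∀ q ∈ P.points, (¬ ∃ g ∈ P.lattice, q = w + g) → ρ ≤ dist p q) {G : ℝ}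
    (hgain : (∑' q : {q : EuclideanSpace ℝ (Fin 3) //
        (q ∈ P.points ∧ ¬ ∃ g ∈ P.lattice, q = w + g) ∧ q ≠ p}, lennardJones (dist p q.1)) ≤
      (∑' q : {q : EuclideanSpace ℝ (Fin 3) //
        (q ∈ P.points ∧ ¬ ∃ g ∈ P.lattice, q = w + g) ∧ q ≠ w}, lennardJones (dist w q.1)) - G) :
    (⨅ Q : PeriodicConfiguration 3, Q.energyPerParticle lennardJones) + G / (P.motif.card : ℝ)
      ≤ P.energyPerParticle lennardJones := by
  obtain ⟨P₀, h0m, h0l, h0p, hmotif, hpts, ρ₀, hρ₀, hclear₀⟩ :=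
    exists_erase_periodicConfiguration P hw h2
  -- removal identity
  have hRem := stub_periodicInsertion P₀ P w ρ₀ hρ₀ hclear₀ hmotif hpts
  -- `p` is off `P₀.points`, with clearance `ρ`
  have hclearP0 : ∀ q ∈ P₀.points, ρ ≤ dist p q := fun q hq =>
    hclear q ((h0p q).1 hq).1 ((h0p q).1 hq).2
  have hp0 : p ∉ P₀.points := fun h => by
    have := hclearP0 p h; rw [dist_self] at this; linarith
  have hineq : ∀ y ∈ P₀.motif, p - y ∉ P₀.lattice := fun y hy hmem =>
    hp0 ⟨y, hy, p - y, hmem, by abel⟩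
  -- the moved configuration `P' = P₀ ⊕ p`
  obtain ⟨P', hm', -, hp'⟩ := exists_insert_periodicConfiguration P₀ p hineq
  have hIns := stub_periodicInsertion P₀ P' p ρ hρ hclearP0 hm' hp'
  -- the two binding sums over `P₀.points`, re-read in `P`
  have hsubP : ∀ q, q ∈ P₀.points ↔ (q ∈ P.points ∧ ¬ ∃ g ∈ P.lattice, q = w + g) := h0p
  have hreidx : ∀ (x : EuclideanSpace ℝ (Fin 3)),
      (∑' q : {q : EuclideanSpace ℝ (Fin 3) // q ∈ P₀.points ∧ q ≠ x}, lennardJones (dist x q.1)) =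
      ∑' q : {q : EuclideanSpace ℝ (Fin 3) //
        (q ∈ P.points ∧ ¬ ∃ g ∈ P.lattice, q = w + g) ∧ q ≠ x}, lennardJones (dist x q.1) := by
    intro x
    let e : {q : EuclideanSpace ℝ (Fin 3) // q ∈ P₀.points ∧ q ≠ x} ≃
        {q : EuclideanSpace ℝ (Fin 3) // (q ∈ P.points ∧ ¬ ∃ g ∈ P.lattice, q = w + g) ∧ q ≠ x} :=
      { toFun := fun q => ⟨q.1, (hsubP q.1).1 q.2.1, q.2.2⟩
        invFun := fun q => ⟨q.1, (hsubP q.1).2 q.2.1, q.2.2⟩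
        left_inv := fun q => by ext; rfl
        right_inv := fun q => by ext; rfl }
    rw [← Equiv.tsum_eq e.symm]; rfl
  rw [hreidx p] at hIns
  rw [hreidx w] at hRem
  -- cardinalities
  have hcard0 : (P₀.motif.card : ℝ) = P.motif.card - 1 := by
    rw [h0m, Finset.card_erase_of_mem hw]
    have : 1 ≤ P.motif.card := by omega
    push_cast [Nat.cast_sub this]
    ring
  rw [hcard0] at hIns hRem
  have hn : (2 : ℝ) ≤ (P.motif.card : ℝ) := by exact_mod_cast h2
  have hstar : (⨅ Q : PeriodicConfiguration 3, Q.energyPerParticle lennardJones) ≤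
      P'.energyPerParticle lennardJones :=
    ciInf_le ChargedEnergyGapNegative.bddBelow_energyPerParticle_lennardJones P'
  -- n e(P') = n e(P) + W_p − W_w ≤ n e(P) − G
  have hmain : (P.motif.card : ℝ) * P'.energyPerParticle lennardJones ≤
      (P.motif.card : ℝ) * P.energyPerParticle lennardJones - G := by
    nlinarith [hIns, hRem, hgain]
  have hdiv : G / (P.motif.card : ℝ) ≤
      P.energyPerParticle lennardJones - P'.energyPerParticle lennardJones := by
    rw [div_le_iff₀ (by linarith)]
    nlinarith
  linarith

/-- **Registered sub-goal `stub_torusLoose` of the line `Sketch`** (the loose-orbit species in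
closed form). [folklore] -/
theorem stub_torusLoose :
    ∀ (P : PeriodicConfiguration 3) (w : EuclideanSpace ℝ (Fin 3)) (G : ℝ), w ∈ P.motif → 2 ≤ P.motif.card →
      (∀ g ∈ P.lattice, g ≠ 0 → (9 / 10 : ℝ) ≤ ‖g‖) →
      P.energyPerParticle lennardJones + G ≤
        (∑' q : {q : EuclideanSpace ℝ (Fin 3) // q ∈ P.points ∧ q ≠ w}, lennardJones (dist w q.1)) →
      (⨅ Q : PeriodicConfiguration 3, Q.energyPerParticle lennardJones) + G / ((P.motif.card : ℝ) - 1)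
        ≤ P.energyPerParticle lennardJones :=
  fun P _ _ hw h2 hper hB => eStar_add_le_of_loose P hw h2 hper hB

end Summit.AtomisticToContinuum.Crystallization.Theorems.PhononSlackCertificatesNearFarGlueR

end
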